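import Summits.CriticalPhenomena.PercolationContinuityZ3.Theorems.PercNearOneGluingNoHeavyLowerTailSunflowerMultiPetalClutterTypeVector
import HarnessLib
import HarnessLib.Audit

/-!
# `NoHeavyLowerTail` (crux stmt-CriticalPhenomena-4575), abstract sunflower cubic, `k` petals: LEMMA B IS CLOSED UNDER DISJOINT UNION for coloured
# clutters — `0 ≤ QKW W₁ → 0 ≤ QKW W₂ → 0 ≤ QKW (W₁ ∪ W₂)` when no member meets both windows

Support file (seat `prim-l12-p2` gen 37; `--supports stmt-CriticalPhenomena-4575`; companion of `…MultiPetalClutterTypeVector` (type vectors) and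
`…MultiPetalTypeUnion` (`lemmaB_pair_nonneg`, THEOREM A of the memo)).  No `sorry`; nothing is asserted about the crux.
Memo: run/shared/lean/prim/prim-l12/prim-l12-p2/FINDING-g37-UNION-AND-ONE-SUM.md §2.

If `W₁`, `W₂` are disjoint windows and every (nonempty) member lying inside `W₁ ∪ W₂` lies inside `W₁` or inside `W₂`, then the member count of a block
`X ⊆ W₁ ∪ W₂` is the sum of the counts of `X ∩ W₁` and `X ∩ W₂`, so its cap is the capped sum (`capOf_union`); ordered 3-partitions of `W₁ ∪ W₂` are pairs of
ordered 3-partitions of `W₁` and `W₂`, whence the bottom-spectator functional of the union is the capped-convolution bilinear form of the two type vectors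
(`QKW_union_eq_bilinear`).  THEOREM A (`lemmaB_pair_nonneg`) then gives `QKW_union_nonneg`: Lemma B (`0 ≤ QKW`, gen 36) passes from the parts to the union;
with `QKW ≤ ZKW` this yields ★ₖ-type conclusions for disjoint unions of Lemma-B clutters (`ZKW_union_nonneg_of_QKW`).
-/

namespace Summit.CriticalPhenomena.PercolationContinuityZ3.Theorems.SunflowerPartition

open Finset

variable {α : Type*} [DecidableEq α] [Fintype α] {k : ℕ} (E : Fin k → Finset α)

omit [Fintype α] in
/-- Member counts add over a separated pair of windows. [this work] -/
theorem memCount_union (hne : ∀ i, (E i).Nonempty) {W₁ W₂ : Finset α} (hW : Disjoint W₁ W₂)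
    (hsep : ∀ i, E i ⊆ W₁ ∪ W₂ → E i ⊆ W₁ ∨ E i ⊆ W₂) {X : Finset α} (hX : X ⊆ W₁ ∪ W₂) :
    memCount E X = memCount E (X ∩ W₁) + memCount E (X ∩ W₂) := by
  unfold memCount
  rw [← card_union_of_disjoint]
  · congr 1
    ext i
    simp only [mem_filter, mem_univ, true_and, mem_union]
    constructor
    · intro hi
      rcases hsep i (hi.trans hX) with h | h
      · exact Or.inl (subset_inter hi h)
      · exact Or.inr (subset_inter hi h)
    · rintro (h | h)
      · exact h.trans inter_subset_left
      · exact h.trans inter_subset_left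
  · rw [disjoint_left]
    intro i h1 h2
    rw [mem_filter] at h1 h2
    obtain ⟨x, hx⟩ := hne i
    exact disjoint_left.1 hW (mem_inter.1 (h1.2 hx)).2 (mem_inter.1 (h2.2 hx)).2

omit [Fintype α] in
/-- Caps add (capped) over a separated pair of windows. [this work] -/
theorem capOf_union (hne : ∀ i, (E i).Nonempty) {W₁ W₂ : Finset α} (hW : Disjoint W₁ W₂)
    (hsep : ∀ i, E i ⊆ W₁ ∪ W₂ → E i ⊆ W₁ ∨ E i ⊆ W₂) {X : Finset α} (hX : X ⊆ W₁ ∪ W₂) :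
    capOf E X = capAdd (capOf E (X ∩ W₁)) (capOf E (X ∩ W₂)) := by
  unfold capOf capAdd
  rw [Fin.ext_iff]
  simp only
  rw [memCount_union E hne hW hsep hX]
  omega

/-- `QKW` as a sum over `pparts` of `lbW` of the type (restated from the companion file's proof). [this work] -/
theorem QKW_eq_sum_pparts (hne : ∀ i, (E i).Nonempty) (W : Finset α) :
    (MSunflower.ofClutter E).QKW W = ∑ q ∈ pparts W, lbW (typeOf E W q) := by
  unfold MSunflower.QKW
  rw [nested_eq_sum_filter]
  refine sum_congr rfl fun q hq => ?_
  have hd : Disjoint q.1 q.2 := (mem_filter.1 hq).2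
  have h13 : Disjoint q.1 (W \ (q.1 ∪ q.2)) := Finset.disjoint_sdiff.mono_left subset_union_left
  have h23 : Disjoint q.2 (W \ (q.1 ∪ q.2)) := Finset.disjoint_sdiff.mono_left subset_union_right
  exact qK_lab_eq_lbW E hne hd h13 h23

omit [Fintype α] in
/-- Regrouping a sum over the ordered 3-partitions of `W` by capped type. [this work] -/
theorem sum_pparts_typeCount (W : Finset α) (f : CType → ℤ) :
    ∑ q ∈ pparts W, f (typeOf E W q) = ∑ t, typeCount E W t * f t := by
  rw [← sum_fiberwise_of_maps_to (s := pparts W) (t := (univ : Finset CType)) (g := typeOf E W) (fun _ _ => mem_univ _)]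
  refine sum_congr rfl fun t _ => ?_
  rw [sum_congr rfl fun q hq => by rw [(mem_filter.1 hq).2], sum_const, typeCount]
  simp [mul_comm]

/-- **The functional of a separated union is the bilinear form of the two type vectors.** [this work] -/
theorem QKW_union_eq_bilinear (hne : ∀ i, (E i).Nonempty) {W₁ W₂ : Finset α} (hW : Disjoint W₁ W₂)
    (hsep : ∀ i, E i ⊆ W₁ ∪ W₂ → E i ⊆ W₁ ∨ E i ⊆ W₂) :
    (MSunflower.ofClutter E).QKW (W₁ ∪ W₂)
      = ∑ s, ∑ t, typeCount E W₁ s * typeCount E W₂ t * lbW (ctAdd s t) := by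
  rw [QKW_eq_sum_pparts E hne]
  -- step 1: partitions of the union are pairs of partitions
  have hsplit : ∑ q ∈ pparts (W₁ ∪ W₂), lbW (typeOf E (W₁ ∪ W₂) q)
      = ∑ p ∈ pparts W₁ ×ˢ pparts W₂, lbW (ctAdd (typeOf E W₁ p.1) (typeOf E W₂ p.2)) := by
    refine sum_nbij' (fun q => ((q.1 ∩ W₁, q.2 ∩ W₁), (q.1 ∩ W₂, q.2 ∩ W₂)))
      (fun p => (p.1.1 ∪ p.2.1, p.1.2 ∪ p.2.2)) ?_ ?_ ?_ ?_ ?_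
    · intro q hq
      rw [mem_pparts] at hq
      rw [mem_product, mem_pparts, mem_pparts]
      exact ⟨⟨⟨inter_subset_right, inter_subset_right⟩, hq.2.mono inter_subset_left inter_subset_left⟩,
        ⟨⟨inter_subset_right, inter_subset_right⟩, hq.2.mono inter_subset_left inter_subset_left⟩⟩
    · intro p hp
      rw [mem_product, mem_pparts, mem_pparts] at hp
      rw [mem_pparts]
      obtain ⟨⟨⟨h11, h12⟩, hd1⟩, ⟨⟨h21, h22⟩, hd2⟩⟩ := hp
      refine ⟨⟨union_subset_union h11 h21, union_subset_union h12 h22⟩, ?_⟩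
      rw [disjoint_union_left, disjoint_union_right, disjoint_union_right]
      exact ⟨⟨hd1, hW.mono h11 h22⟩, ⟨(hW.mono h12 h21).symm, hd2⟩⟩
    · intro q hq
      rw [mem_pparts] at hq
      obtain ⟨⟨h1, h2⟩, _⟩ := hq
      show ((q.1 ∩ W₁) ∪ (q.1 ∩ W₂), (q.2 ∩ W₁) ∪ (q.2 ∩ W₂)) = q
      rw [← inter_union_distrib_left, ← inter_union_distrib_left, inter_eq_left.2 h1, inter_eq_left.2 h2]
    · intro p hp
      rw [mem_product, mem_pparts, mem_pparts] at hp
      obtain ⟨⟨⟨h11, h12⟩, _⟩, ⟨⟨h21, h22⟩, _⟩⟩ := hp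
      have e1 : (p.1.1 ∪ p.2.1) ∩ W₁ = p.1.1 := by
        rw [union_inter_distrib_right, inter_eq_left.2 h11, disjoint_iff_inter_eq_empty.1 (hW.symm.mono_left h21), union_empty]
      have e2 : (p.1.2 ∪ p.2.2) ∩ W₁ = p.1.2 := by
        rw [union_inter_distrib_right, inter_eq_left.2 h12, disjoint_iff_inter_eq_empty.1 (hW.symm.mono_left h22), union_empty]
      have e3 : (p.1.1 ∪ p.2.1) ∩ W₂ = p.2.1 := by
        rw [union_inter_distrib_right, inter_eq_left.2 h21, disjoint_iff_inter_eq_empty.1 (hW.mono_left h11), empty_union]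
      have e4 : (p.1.2 ∪ p.2.2) ∩ W₂ = p.2.2 := by
        rw [union_inter_distrib_right, inter_eq_left.2 h22, disjoint_iff_inter_eq_empty.1 (hW.mono_left h12), empty_union]
      show (((p.1.1 ∪ p.2.1) ∩ W₁, (p.1.2 ∪ p.2.2) ∩ W₁), ((p.1.1 ∪ p.2.1) ∩ W₂, (p.1.2 ∪ p.2.2) ∩ W₂)) = p
      rw [e1, e2, e3, e4]
    · intro q hq
      rw [mem_pparts] at hq
      obtain ⟨⟨h1, h2⟩, hd⟩ := hq
      have hT : (W₁ ∪ W₂) \ (q.1 ∪ q.2) ⊆ W₁ ∪ W₂ := sdiff_subset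
      have eT1 : ((W₁ ∪ W₂) \ (q.1 ∪ q.2)) ∩ W₁ = W₁ \ (q.1 ∩ W₁ ∪ q.2 ∩ W₁) := by
        ext x
        simp only [mem_inter, mem_sdiff, mem_union]
        tauto
      have eT2 : ((W₁ ∪ W₂) \ (q.1 ∪ q.2)) ∩ W₂ = W₂ \ (q.1 ∩ W₂ ∪ q.2 ∩ W₂) := by
        ext x
        simp only [mem_inter, mem_sdiff, mem_union]
        tauto
      show lbW (typeOf E (W₁ ∪ W₂) q) = lbW (ctAdd (typeOf E W₁ (q.1 ∩ W₁, q.2 ∩ W₁)) (typeOf E W₂ (q.1 ∩ W₂, q.2 ∩ W₂)))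
      unfold typeOf ctAdd
      simp only
      rw [capOf_union E hne hW hsep h1, capOf_union E hne hW hsep h2, capOf_union E hne hW hsep hT, eT1, eT2]
  rw [hsplit, sum_product]
  -- step 2: regroup both factors by type
  rw [sum_congr rfl fun x _ => sum_pparts_typeCount E W₂ (fun t => lbW (ctAdd (typeOf E W₁ x) t)),
    sum_pparts_typeCount E W₁ (fun s => ∑ t, typeCount E W₂ t * lbW (ctAdd s t))]
  refine sum_congr rfl fun s _ => ?_
  rw [mul_sum]
  refine sum_congr rfl fun t _ => ?_
  ring

/-- **LEMMA B IS CLOSED UNDER DISJOINT UNION (clutter form of THEOREM A).**  If no member meets both of two disjoint windows, then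
`0 ≤ QKW W₁` and `0 ≤ QKW W₂` imply `0 ≤ QKW (W₁ ∪ W₂)` for the clutter structure of any family of nonempty members. [this work] -/
theorem QKW_union_nonneg (hne : ∀ i, (E i).Nonempty) {W₁ W₂ : Finset α} (hW : Disjoint W₁ W₂)
    (hsep : ∀ i, E i ⊆ W₁ ∪ W₂ → E i ⊆ W₁ ∨ E i ⊆ W₂)
    (h₁ : 0 ≤ (MSunflower.ofClutter E).QKW W₁) (h₂ : 0 ≤ (MSunflower.ofClutter E).QKW W₂) :
    0 ≤ (MSunflower.ofClutter E).QKW (W₁ ∪ W₂) := by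
  rw [QKW_union_eq_bilinear E hne hW hsep]
  rw [QKW_eq_sum_typeCount E hne] at h₁ h₂
  have h₁' : 0 ≤ ∑ t, lbW t * typeCount E W₁ t := h₁
  have h₂' : 0 ≤ ∑ t, lbW t * typeCount E W₂ t := h₂
  exact lemmaB_pair_nonneg (typeCount E W₁) (typeCount E W₂) (typeCount_nonneg E W₁) (typeCount_nonneg E W₂)
    (typeCount_swap12 E W₁) (typeCount_swap23 E W₁) (typeCount_swap12 E W₂) (typeCount_swap23 E W₂) h₁' h₂'

/-- **★ₖ-type corollary**: under the same hypotheses `0 ≤ ZKW (W₁ ∪ W₂)` (`QKW ≤ ZKW`, gen 36). [this work] -/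
theorem ZKW_union_nonneg_of_QKW (hne : ∀ i, (E i).Nonempty) {W₁ W₂ : Finset α} (hW : Disjoint W₁ W₂)
    (hsep : ∀ i, E i ⊆ W₁ ∪ W₂ → E i ⊆ W₁ ∨ E i ⊆ W₂)
    (h₁ : 0 ≤ (MSunflower.ofClutter E).QKW W₁) (h₂ : 0 ≤ (MSunflower.ofClutter E).QKW W₂) :
    0 ≤ (MSunflower.ofClutter E).ZKW (W₁ ∪ W₂) :=
  le_trans (QKW_union_nonneg E hne hW hsep h₁ h₂) ((MSunflower.ofClutter E).QKW_le_ZKW (W₁ ∪ W₂))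

end Summit.CriticalPhenomena.PercolationContinuityZ3.Theorems.SunflowerPartition
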